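import Mathlib.Analysis.SpecialFunctions.Trigonometric.Sinc
import Mathlib.Analysis.SpecialFunctions.Trigonometric.Bounds
import Mathlib.Analysis.InnerProductSpace.PiL2
import Literature.MathematicalPhysics.QuantumLattice.HeisenbergOrderNeelRiemann3
import HarnessLib

/-!
# Route `BECSubharmonicContinuation`, support `CoreDeficitBounds` (stmt-AtomisticToContinuum-9004) —
# helper: the three-variable weight inequality

The elementary inequality behind clause (b) of `CoreDeficitBounds`: for every `u ∈ ℝ³`,

`1 - cos ‖u‖ ≤ 8 · (1 - ∏ⱼ sinc²(uⱼ/2))`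

(`weight_ineq`). Per Fourier mode `k` of the torus, with `u = kR`, the left side is the
multiplier of the core potential `(4π)⁻¹∫_{B_R} H/|y|` and `1 - ∏ⱼ sinc²(uⱼ/2)` is the
multiplier of the translate-averaged cube deficit of side `R` (Fejér), so the inequality is
exactly the termwise comparison of the two (the sharp constant is `6`, attained as `u → 0`).

Proof: if some `sinc²(uⱼ/2) ≤ 3/4` the right side is `≥ 2 ≥ 1 - cos ‖u‖`. Otherwise every
`|uⱼ| < 2` (`sinc_sq_half_le_of_two_le`), so `‖u‖ ≤ 4`; on `(0, 4]` the function
`(1 - cos x)/x² = sinc²(x/2)/2` is decreasing (`sinc` decreases on `[0, π]`,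
`sin_div_le_sin_div`), which gives the subadditivity `1 - cos ‖u‖ ≤ ∑ⱼ (1 - cos uⱼ)`; the
one-variable inequality `1 - cos t ≤ 6 (1 - sinc²(t/2))` (`one_sub_cos_le_six_mul`, from the
degree-six Taylor bound `taylor_six_le_cos` of `KLSNumerics`) and the algebraic fact
`(1-x)(1-y)(1-z) ≤ 1 - ¾(x+y+z)` on `[0, ¼]³` finish.
-/

noncomputable section

open Real

namespace Summit.AtomisticToContinuum.BoseEinsteinCondensation.Theorems.CoreDeficitBounds

/-! ### One-variable facts -/

/-- The degree-six Taylor lower bound for the cosine on all of `ℝ`: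
`1 - t²/2 + t⁴/24 - t⁶/720 ≤ cos t`. -/
theorem taylor_six_le_cos_real (t : ℝ) :
    1 - t ^ 2 / 2 + t ^ 4 / 24 - t ^ 6 / 720 ≤ Real.cos t := by
  rcases le_total 0 t with ht | ht
  · exact Literature.MathematicalPhysics.QuantumLattice.KLSNumerics.taylor_six_le_cos ht
  · have h := Literature.MathematicalPhysics.QuantumLattice.KLSNumerics.taylor_six_le_cos
      (neg_nonneg.2 ht)
    rw [Real.cos_neg] at h
    have e : 1 - (-t) ^ 2 / 2 + (-t) ^ 4 / 24 - (-t) ^ 6 / 720 =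
        1 - t ^ 2 / 2 + t ^ 4 / 24 - t ^ 6 / 720 := by ring
    linarith

/-- The polynomial form of the one-variable weight inequality:
`(1 - cos t)(t² + 12) ≤ 6 t²` for every real `t` (Taylor to degree six for `t² ≤ 18`,
`1 - cos t ≤ 2` beyond). -/
theorem one_sub_cos_mul_sq_add_le (t : ℝ) : (1 - Real.cos t) * (t ^ 2 + 12) ≤ 6 * t ^ 2 := by
  by_cases h : t ^ 2 ≤ 18
  · have hP : 1 - Real.cos t ≤ t ^ 2 / 2 - t ^ 4 / 24 + t ^ 6 / 720 := by
      linarith [taylor_six_le_cos_real t]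
    have h12 : (0 : ℝ) ≤ t ^ 2 + 12 := by positivity
    calc (1 - Real.cos t) * (t ^ 2 + 12)
        ≤ (t ^ 2 / 2 - t ^ 4 / 24 + t ^ 6 / 720) * (t ^ 2 + 12) :=
          mul_le_mul_of_nonneg_right hP h12
      _ = 6 * t ^ 2 - (t ^ 2) ^ 3 * (18 - t ^ 2) / 720 := by ring
      _ ≤ 6 * t ^ 2 := by
          have : 0 ≤ (t ^ 2) ^ 3 * (18 - t ^ 2) := mul_nonneg (by positivity) (by linarith)
          linarith
  · push Not at h
    have hc2 : 1 - Real.cos t ≤ 2 := by linarith [Real.neg_one_le_cos t]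
    have hc0 : 0 ≤ 1 - Real.cos t := by linarith [Real.cos_le_one t]
    nlinarith

/-- `sinc²(t/2) = 2(1 - cos t)/t²` for `t ≠ 0` (half-angle formula). -/
theorem sinc_half_sq {t : ℝ} (ht : t ≠ 0) :
    Real.sinc (t / 2) ^ 2 = 2 * (1 - Real.cos t) / t ^ 2 := by
  rw [Real.sinc_of_ne_zero (div_ne_zero ht two_ne_zero), div_pow, Real.sin_sq_eq_half_sub,
    show 2 * (t / 2) = t by ring]
  field_simp

/-- **The one-variable weight inequality**: `1 - cos t ≤ 6 (1 - sinc²(t/2))` for every real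
`t` (equality to fourth order at `t = 0`). -/
theorem one_sub_cos_le_six_mul (t : ℝ) :
    1 - Real.cos t ≤ 6 * (1 - Real.sinc (t / 2) ^ 2) := by
  rcases eq_or_ne t 0 with rfl | ht
  · simp
  · rw [sinc_half_sq ht]
    have ht2 : 0 < t ^ 2 := by positivity
    have key := one_sub_cos_mul_sq_add_le t
    rw [show 6 * (1 - 2 * (1 - Real.cos t) / t ^ 2) = (6 * t ^ 2 - 12 * (1 - Real.cos t)) / t ^ 2 by
      field_simp; ring]
    rw [le_div_iff₀ ht2]
    nlinarith

/-- `x cos x ≤ sin x` on `[0, π]` (`x ≤ tan x` below `π/2`, signs above). -/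
theorem mul_cos_le_sin {x : ℝ} (h0 : 0 ≤ x) (hπ : x ≤ π) : x * Real.cos x ≤ Real.sin x := by
  by_cases hx : x < π / 2
  · have hcos : 0 < Real.cos x := Real.cos_pos_of_mem_Ioo ⟨by linarith [Real.pi_pos], hx⟩
    have htan := Real.le_tan h0 hx
    rw [Real.tan_eq_sin_div_cos, le_div_iff₀ hcos] at htan
    exact htan
  · push Not at hx
    have hcos : Real.cos x ≤ 0 :=
      Real.cos_nonpos_of_pi_div_two_le_of_le hx (by linarith [Real.pi_pos])
    have hsin : 0 ≤ Real.sin x := Real.sin_nonneg_of_nonneg_of_le_pi h0 hπ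
    nlinarith

/-- **`sin x / x` decreases on `(0, π]`**: for `0 < a ≤ b ≤ π`, `sin b / b ≤ sin a / a`
(the function `x ↦ x sin a - a sin x` is non-decreasing on `[a, π]`). -/
theorem sin_div_le_sin_div {a b : ℝ} (ha : 0 < a) (hab : a ≤ b) (hb : b ≤ π) :
    Real.sin b / b ≤ Real.sin a / a := by
  have hb0 : 0 < b := lt_of_lt_of_le ha hab
  let f : ℝ → ℝ := fun x => x * Real.sin a - a * Real.sin x
  have hderiv : ∀ x, deriv f x = Real.sin a - a * Real.cos x := by
    intro x
    simp (disch := fun_prop) [f]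
  have hmono : MonotoneOn f (Set.Icc a π) := by
    apply monotoneOn_of_deriv_nonneg (convex_Icc a π) (by fun_prop) (by fun_prop)
    intro x hx
    rw [interior_Icc, Set.mem_Ioo] at hx
    rw [hderiv]
    have h1 : Real.cos x ≤ Real.cos a :=
      Real.cos_le_cos_of_nonneg_of_le_pi ha.le hx.2.le hx.1.le
    have h2 : a * Real.cos a ≤ Real.sin a := mul_cos_le_sin ha.le (by linarith)
    nlinarith
  have hfa : f a ≤ f b := hmono ⟨le_rfl, by linarith⟩ ⟨hab, hb⟩ hab
  have hfa0 : f a = 0 := by simp only [f]; ring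
  rw [hfa0] at hfa
  simp only [f, sub_nonneg] at hfa
  rw [div_le_div_iff₀ hb0 ha]
  linarith

/-- **`(1 - cos x)/x²` decreases on `(0, 4]`**: for `0 < x ≤ y ≤ 4`,
`(1 - cos y)/y² ≤ (1 - cos x)/x²` (it is `sinc²(·/2)/2` and `sinc` decreases on `[0, π] ⊇ [0, 2]`). -/
theorem one_sub_cos_div_sq_antitone {x y : ℝ} (hx : 0 < x) (hxy : x ≤ y) (hy : y ≤ 4) :
    (1 - Real.cos y) / y ^ 2 ≤ (1 - Real.cos x) / x ^ 2 := by
  have hy0 : 0 < y := lt_of_lt_of_le hx hxy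
  have ex : (1 - Real.cos x) / x ^ 2 = Real.sinc (x / 2) ^ 2 / 2 := by
    rw [sinc_half_sq hx.ne']; field_simp
  have ey : (1 - Real.cos y) / y ^ 2 = Real.sinc (y / 2) ^ 2 / 2 := by
    rw [sinc_half_sq hy0.ne']; field_simp
  rw [ex, ey]
  have hπ : y / 2 ≤ π := by linarith [Real.two_le_pi]
  have hs : Real.sinc (y / 2) ≤ Real.sinc (x / 2) := by
    rw [Real.sinc_of_ne_zero (by positivity : 0 < y / 2).ne',
      Real.sinc_of_ne_zero (by positivity : 0 < x / 2).ne']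
    exact sin_div_le_sin_div (by positivity) (by linarith) hπ
  have hs0 : 0 ≤ Real.sinc (y / 2) := by
    rw [Real.sinc_of_ne_zero (by positivity : 0 < y / 2).ne']
    exact div_nonneg (Real.sin_nonneg_of_nonneg_of_le_pi (by positivity) hπ) (by positivity)
  have := pow_le_pow_left₀ hs0 hs 2
  linarith

/-- **Support of the deficit weight**: `|t| ≥ 2 ⇒ sinc²(t/2) ≤ 3/4` (`sinc x ≤ 1/x` for
`x² ≥ 4/3`, the degree-five Taylor bound for the sine on `1 ≤ x² ≤ 4/3`). -/
theorem sinc_sq_half_le_of_two_le {t : ℝ} (ht : 2 ≤ |t|) : Real.sinc (t / 2) ^ 2 ≤ 3 / 4 := by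
  -- reduce to `x = |t|/2 ≥ 1`
  have hsq : Real.sinc (t / 2) ^ 2 = Real.sinc (|t| / 2) ^ 2 := by
    rcases le_total 0 t with h | h
    · rw [abs_of_nonneg h]
    · rw [abs_of_nonpos h, neg_div, Real.sinc_neg]
  rw [hsq]
  set x : ℝ := |t| / 2 with hxdef
  have hx1 : 1 ≤ x := by rw [hxdef]; linarith
  have hx0 : 0 < x := by linarith
  rw [Real.sinc_of_ne_zero hx0.ne']
  by_cases hbig : 4 / 3 ≤ x ^ 2
  · -- `(sin x / x)² ≤ 1/x² ≤ 3/4`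
    rw [div_pow]
    have hs : Real.sin x ^ 2 ≤ 1 := Real.sin_sq_le_one x
    rw [div_le_iff₀ (by positivity)]
    nlinarith
  · push Not at hbig
    have hxπ : x ≤ π := by nlinarith [Real.pi_gt_three]
    have hsin0 : 0 ≤ Real.sin x := Real.sin_nonneg_of_nonneg_of_le_pi hx0.le hxπ
    have hsin5 := Literature.MathematicalPhysics.QuantumLattice.KLSNumerics.sin_le_taylor_five hx0.le
    have hup : Real.sin x / x ≤ 1 - x ^ 2 / 6 + x ^ 4 / 120 := by
      rw [div_le_iff₀ hx0]
      nlinarith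
    have hpoly : 1 - x ^ 2 / 6 + x ^ 4 / 120 ≤ 101 / 120 := by
      have hs1 : 1 ≤ x ^ 2 := by nlinarith
      have e : 1 - x ^ 2 / 6 + x ^ 4 / 120 - 101 / 120 = (x ^ 2 - 1) * (x ^ 2 - 19) / 120 := by ring
      have hneg : (x ^ 2 - 1) * (x ^ 2 - 19) ≤ 0 :=
        mul_nonpos_of_nonneg_of_nonpos (by linarith) (by linarith)
      linarith
    have hlo : 0 ≤ Real.sin x / x := div_nonneg hsin0 hx0.le
    have h1 : Real.sin x / x ≤ 101 / 120 := hup.trans hpoly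
    nlinarith

/-- The algebra of the small-deficit case: `(1-x)(1-y)(1-z) ≤ 1 - ¾(x+y+z)` on `[0, ¼]³`. -/
theorem prod_one_sub_le {x y z : ℝ} (hx : 0 ≤ x) (hy : 0 ≤ y) (hz : 0 ≤ z) (hx' : x ≤ 1 / 4)
    (hy' : y ≤ 1 / 4) (hz' : z ≤ 1 / 4) :
    (1 - x) * (1 - y) * (1 - z) ≤ 1 - 3 / 4 * (x + y + z) := by
  have h1 : x * y ≤ 1 / 4 * y := mul_le_mul_of_nonneg_right hx' hy
  have h2 : y * z ≤ 1 / 4 * z := mul_le_mul_of_nonneg_right hy' hz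
  have h3 : z * x ≤ 1 / 4 * x := mul_le_mul_of_nonneg_right hz' hx
  have h4 : 0 ≤ x * y * z := by positivity
  nlinarith

/-! ### The three-variable inequality -/

/-- **Subadditivity of `1 - cos` along the norm** (small vectors): if `‖u‖ ≤ 4` then
`1 - cos ‖u‖ ≤ ∑ⱼ (1 - cos uⱼ)` (since `(1 - cos x)/x²` decreases on `(0, 4]` and
`‖u‖² = ∑ⱼ uⱼ²`). -/
theorem one_sub_cos_norm_le_sum (u : EuclideanSpace ℝ (Fin 3)) (hu : ‖u‖ ≤ 4) :
    1 - Real.cos ‖u‖ ≤ ∑ j, (1 - Real.cos (u j)) := by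
  rcases eq_or_lt_of_le (norm_nonneg u) with h0 | hpos
  · rw [← h0, Real.cos_zero, sub_self]
    exact Finset.sum_nonneg fun j _ => by linarith [Real.cos_le_one (u j)]
  · set r : ℝ := ‖u‖ with hr
    -- `1 - cos r = ((1 - cos r)/r²) · ∑ⱼ uⱼ²`
    have hsq : r ^ 2 = ∑ j, (u j) ^ 2 := EuclideanSpace.real_norm_sq_eq u
    have hrepr : 1 - Real.cos r = ∑ j, (1 - Real.cos r) / r ^ 2 * (u j) ^ 2 := by
      rw [← Finset.mul_sum, ← hsq]
      field_simp
    rw [hrepr]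
    refine Finset.sum_le_sum fun j _ => ?_
    rcases eq_or_ne (u j) 0 with hj | hj
    · rw [hj]; simp
    · have hapos : 0 < |u j| := abs_pos.2 hj
      have hale : |u j| ≤ r := by
        have h := PiLp.norm_apply_le u j
        rwa [Real.norm_eq_abs] at h
      have hmono := one_sub_cos_div_sq_antitone hapos hale hu
      calc (1 - Real.cos r) / r ^ 2 * (u j) ^ 2
          ≤ (1 - Real.cos |u j|) / |u j| ^ 2 * (u j) ^ 2 :=
            mul_le_mul_of_nonneg_right hmono (sq_nonneg _)
        _ = 1 - Real.cos (u j) := by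
            rw [Real.cos_abs, sq_abs]
            field_simp

/-- **The weight inequality.** For every `u ∈ ℝ³`,
`1 - cos ‖u‖ ≤ 8 (1 - ∏ⱼ sinc²(uⱼ/2))`: per torus mode `k` (`u = kR`) the multiplier of the
core potential `(4π)⁻¹∫_{B_R} H/|y|` is at most `8` times the multiplier of the
translate-averaged cube-condensation deficit of side `R`. -/
theorem weight_ineq (u : EuclideanSpace ℝ (Fin 3)) :
    1 - Real.cos ‖u‖ ≤ 8 * (1 - ∏ j, Real.sinc (u j / 2) ^ 2) := by
  set p : Fin 3 → ℝ := fun j => Real.sinc (u j / 2) ^ 2 with hp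
  have hp0 : ∀ j, 0 ≤ p j := fun j => sq_nonneg _
  have hp1 : ∀ j, p j ≤ 1 := fun j =>
    (sq_le_one_iff_abs_le_one _).2 (Real.abs_sinc_le_one _)
  have hcos2 : 1 - Real.cos ‖u‖ ≤ 2 := by linarith [Real.neg_one_le_cos ‖u‖]
  show 1 - Real.cos ‖u‖ ≤ 8 * (1 - ∏ j, p j)
  rw [Fin.prod_univ_three]
  by_cases hcase : ∃ j, p j ≤ 3 / 4
  · -- some factor is at most `3/4`: the right side is at least `2`
    obtain ⟨j, hj⟩ := hcase
    have h01 := hp0 0; have h02 := hp0 1; have h03 := hp0 2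
    have h11 := hp1 0; have h12 := hp1 1; have h13 := hp1 2
    have hprod : p 0 * p 1 * p 2 ≤ 3 / 4 := by
      fin_cases j
      · calc p 0 * p 1 * p 2 ≤ p 0 * 1 * 1 := by gcongr
          _ ≤ 3 / 4 := by simpa using hj
      · calc p 0 * p 1 * p 2 ≤ 1 * p 1 * 1 := by gcongr
          _ ≤ 3 / 4 := by simpa using hj
      · calc p 0 * p 1 * p 2 ≤ 1 * 1 * p 2 := by gcongr
          _ ≤ 3 / 4 := by simpa using hj
    linarith
  · -- all factors exceed `3/4`: every `|uⱼ| < 2`, so `‖u‖ ≤ 4`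
    push Not at hcase
    have hsmall : ∀ j, |u j| < 2 := fun j => by
      by_contra hcon
      push Not at hcon
      exact absurd (sinc_sq_half_le_of_two_le hcon) (not_le.2 (hcase j))
    have hnorm : ‖u‖ ≤ 4 := by
      have hsq : ‖u‖ ^ 2 = ∑ j, (u j) ^ 2 := EuclideanSpace.real_norm_sq_eq u
      have hle : ∑ j, (u j) ^ 2 ≤ ∑ _j : Fin 3, (4 : ℝ) :=
        Finset.sum_le_sum fun j _ => by
          have hab : |u j| ^ 2 < 2 ^ 2 := pow_lt_pow_left₀ (hsmall j) (abs_nonneg _) two_ne_zero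
          rw [sq_abs] at hab
          linarith
      have h16 : ‖u‖ ^ 2 ≤ 16 := by
        rw [hsq]; refine hle.trans ?_; norm_num
      nlinarith [norm_nonneg u]
    have hA := one_sub_cos_norm_le_sum u hnorm
    have hB : ∑ j, (1 - Real.cos (u j)) ≤ ∑ j, 6 * (1 - p j) :=
      Finset.sum_le_sum fun j _ => one_sub_cos_le_six_mul (u j)
    rw [Fin.sum_univ_three] at hB
    rw [Fin.sum_univ_three] at hA hB
    have hC := prod_one_sub_le (x := 1 - p 0) (y := 1 - p 1) (z := 1 - p 2)
      (by linarith [hp1 0]) (by linarith [hp1 1]) (by linarith [hp1 2])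
      (by linarith [hcase 0]) (by linarith [hcase 1]) (by linarith [hcase 2])
    simp only [sub_sub_cancel] at hC
    linarith

end Summit.AtomisticToContinuum.BoseEinsteinCondensation.Theorems.CoreDeficitBounds

end
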